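import Mathlib
import Summits.NavierStokesRegularity.NavierStokesRegularity.Theorems.EulerZoomLiouvillePowerGaugeEulerLiouvilleSelfSimilarPressureSlavingTools
import HarnessLib

/-!
# Crux E `PowerGaugeEulerLiouville` (stmt-NavierStokesRegularity-19832): PRESSURE SLAVING on a PAST sub-slab — the `D`-growth kills
# functions of time below any top time `S`
# (lane «pressure slaving», file 2 = shifted / past strata; LEAD ns-typeII-p2 g11 10:45:58Z (1); width seat ns-ezl-w3 g2)

Route `EulerZoomLiouville` (NavierStokesRegularity), crux E.  The past-exact strata of the census (`IsPastSelfSimilar ρ T T₁ x₀`,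
`IsShiftedSelfSimilar ρ T x₀`, the past off-rate twin) are self-similar about a centre `(T, x₀)` on a window `τ < T₁` only; after centring,
the window is the slab `s < S := T₁ − T ≤ 0`, which is NOT invariant under all self-similar dilations (only under `β ≥ 1`).  This file is
the top-`S` version of `PressureSlaving.ae_eq_zero_of_ae_const_of_cylinderGrowth` (`…SelfSimilarPressureSlavingTools`, the case `S = 0`):

* `PressureSlaving.ae_eq_zero_of_ae_const_of_cylinderGrowth_top` — a function `F` on the slab `(−∞, S) × ℝ³` which is a.e. constant on
  a.e. slice and has `∫∫_{Q_a(S, 0)} ‖F‖^r ≤ K a^m` for all large `a` (cylinders HANGING FROM THE TOP `S`), with `K < ∞` and `m < 3`, vanishes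
  a.e. on the slab (`∫∫_{Q_N(S,0)} ‖F‖^r = (N/a)³ ∫_{S−N²}^{S} ∫_{B_a} ‖F‖^r ≤ (N/a)³ K a^m → 0`).

WHAT THIS IS NOT: not NS regularity, not the crux E — measure-theoretic bookkeeping for the census of the crux CLASS 19832 on the MODEL
lattice; `--supports` stmt-19832.  [folklore; AlbrittonBarker2019 §1 (`D` does not see functions of time)]
-/

noncomputable section

-- flat `Theorems/<Route><Decl>…` files of one crux share the namespace of the crux (tree convention: `Summit.<S>.<S>.…`)
set_option linter.dupNamespace false

open MeasureTheory Set Filter Topology Metric Function TopologicalSpace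
open scoped ENNReal NNReal

namespace Summit.NavierStokesRegularity.NavierStokesRegularity.Theorems.PowerGaugeEulerLiouville

open Literature.Analysis Literature.Analysis.FunctionSpaces Literature.Analysis.FluidPDE

namespace PressureSlaving

/-- **THE `D`-GROWTH KILLS FUNCTIONS OF TIME BELOW ANY TOP TIME `S`.**  Let `F` be a.e.-strongly measurable on the slab `(−∞, S) × ℝ³`,
a.e. constant on a.e. slice (`F(t, ·) = κ_t` a.e., for a.e. `t < S`), and suppose `∫∫_{Q_a(S, 0)} ‖F‖^r ≤ K a^m` for all `a ≥ a₀` — the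
backward cylinders `Q_a(S, 0) = (S − a², S) × B(0, a)` hanging from the top — with `r > 0`, `K < ∞` and an exponent `m < 3`.  Then `F = 0`
a.e. on the slab.  (`S = 0`: `ae_eq_zero_of_ae_const_of_cylinderGrowth`.) [folklore; AlbrittonBarker2019 §1] -/
theorem ae_eq_zero_of_ae_const_of_cylinderGrowth_top {S : ℝ} {F : ℝ → EuclideanSpace ℝ (Fin 3) → ℝ} {r : ℝ} (hr : 0 < r)
    (hFm : AEStronglyMeasurable (uncurry F)
      (volume.restrict (Iio S ×ˢ (univ : Set (EuclideanSpace ℝ (Fin 3))))))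
    (hconst : ∀ᵐ t ∂(volume.restrict (Iio S)), ∃ κ : ℝ,
      ∀ᵐ x ∂(volume : Measure (EuclideanSpace ℝ (Fin 3))), F t x = κ)
    {K : ℝ≥0∞} (hK : K ≠ ⊤) {m a₀ : ℝ} (hm : m < 3)
    (hgrowth : ∀ a : ℝ, a₀ ≤ a →
      ∫⁻ z in parabolicCylinder a (S, (0 : EuclideanSpace ℝ (Fin 3))), ‖F z.1 z.2‖ₑ ^ r ≤ K * ENNReal.ofReal (a ^ m)) :
    ∀ᵐ z ∂(volume.restrict (Iio S ×ˢ (univ : Set (EuclideanSpace ℝ (Fin 3))))), F z.1 z.2 = 0 := by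
  set f : ℝ × EuclideanSpace ℝ (Fin 3) → ℝ≥0∞ := fun z => ‖F z.1 z.2‖ₑ ^ r with hf
  -- the backward cylinder `Q_R(S, 0) = (S − R², S) × B(0, R)`
  have hQeq : ∀ R : ℝ, parabolicCylinder R (S, (0 : EuclideanSpace ℝ (Fin 3))) =
      Ioo (S - R ^ 2) S ×ˢ ball (0 : EuclideanSpace ℝ (Fin 3)) R := fun R => rfl
  have hfm : AEMeasurable f (volume.restrict (Iio S ×ˢ (univ : Set (EuclideanSpace ℝ (Fin 3))))) :=
    (hFm.aemeasurable.enorm.pow_const r)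
  have hQsub : ∀ R : ℝ, Ioo (S - R ^ 2) S ×ˢ ball (0 : EuclideanSpace ℝ (Fin 3)) R ⊆
      Iio S ×ˢ (univ : Set (EuclideanSpace ℝ (Fin 3))) := fun R =>
    prod_mono (fun t ht => ht.2) (subset_univ _)
  have hfmQ : ∀ R : ℝ, AEMeasurable f
      (((volume : Measure ℝ).restrict (Ioo (S - R ^ 2) S)).prod
        ((volume : Measure (EuclideanSpace ℝ (Fin 3))).restrict (ball 0 R))) := fun R => by
    rw [← volume_restrict_prod]
    exact hfm.mono_measure (Measure.restrict_mono (hQsub R) le_rfl)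
  have htonelli : ∀ R : ℝ, ∫⁻ z in parabolicCylinder R (S, (0 : EuclideanSpace ℝ (Fin 3))), f z =
      ∫⁻ t in Ioo (S - R ^ 2) S, ∫⁻ x in ball (0 : EuclideanSpace ℝ (Fin 3)) R, f (t, x) := fun R => by
    rw [hQeq, volume_restrict_prod, lintegral_prod _ (hfmQ R)]
  -- ## Step 1: `∫∫_{Q_N} ‖F‖^r ≤ K (N/a)³ a^m` for `a ≥ max a₀ N`
  have hbound : ∀ N : ℝ, 0 < N → ∀ a : ℝ, a₀ ≤ a → N ≤ a →
      ∫⁻ z in parabolicCylinder N (S, (0 : EuclideanSpace ℝ (Fin 3))), f z ≤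
        K * ENNReal.ofReal ((N / a) ^ 3 * a ^ m) := by
    intro N hN a ha hNa
    have ha0 : 0 < a := hN.trans_le hNa
    have hslice : ∀ᵐ t ∂((volume : Measure ℝ).restrict (Ioo (S - N ^ 2) S)),
        ∫⁻ x in ball (0 : EuclideanSpace ℝ (Fin 3)) N, f (t, x) =
          ENNReal.ofReal ((N / a) ^ 3) * ∫⁻ x in ball (0 : EuclideanSpace ℝ (Fin 3)) a, f (t, x) := by
      have h' : ∀ᵐ t ∂((volume : Measure ℝ).restrict (Ioo (S - N ^ 2) S)), ∃ κ : ℝ,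
          ∀ᵐ x ∂(volume : Measure (EuclideanSpace ℝ (Fin 3))), F t x = κ :=
        ae_restrict_of_ae_restrict_of_subset (fun t ht => ht.2) hconst
      filter_upwards [h'] with t ht
      obtain ⟨κ, hκ⟩ := ht
      exact setLIntegral_ball_eq_of_ae_const r hκ hN ha0
    calc ∫⁻ z in parabolicCylinder N (S, (0 : EuclideanSpace ℝ (Fin 3))), f z
        = ∫⁻ t in Ioo (S - N ^ 2) S, ∫⁻ x in ball (0 : EuclideanSpace ℝ (Fin 3)) N, f (t, x) := htonelli N
      _ = ∫⁻ t in Ioo (S - N ^ 2) S,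
            ENNReal.ofReal ((N / a) ^ 3) * ∫⁻ x in ball (0 : EuclideanSpace ℝ (Fin 3)) a, f (t, x) :=
          lintegral_congr_ae hslice
      _ = ENNReal.ofReal ((N / a) ^ 3) *
            ∫⁻ t in Ioo (S - N ^ 2) S, ∫⁻ x in ball (0 : EuclideanSpace ℝ (Fin 3)) a, f (t, x) :=
          lintegral_const_mul' _ _ ENNReal.ofReal_ne_top
      _ ≤ ENNReal.ofReal ((N / a) ^ 3) *
            ∫⁻ t in Ioo (S - a ^ 2) S, ∫⁻ x in ball (0 : EuclideanSpace ℝ (Fin 3)) a, f (t, x) := by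
          exact mul_le_mul_right (lintegral_mono_set (Ioo_subset_Ioo (by nlinarith) le_rfl)) _
      _ = ENNReal.ofReal ((N / a) ^ 3) * ∫⁻ z in parabolicCylinder a (S, (0 : EuclideanSpace ℝ (Fin 3))), f z := by
          rw [htonelli a]
      _ ≤ ENNReal.ofReal ((N / a) ^ 3) * (K * ENNReal.ofReal (a ^ m)) := by
          gcongr
          exact hgrowth a ha
      _ = K * ENNReal.ofReal ((N / a) ^ 3 * a ^ m) := by
          rw [ENNReal.ofReal_mul (by positivity)]
          ring
  -- ## Step 2: the bound tends to `0`
  have hzero : ∀ N : ℝ, 0 < N → ∫⁻ z in parabolicCylinder N (S, (0 : EuclideanSpace ℝ (Fin 3))), f z = 0 := by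
    intro N hN
    have hlim : Tendsto (fun a : ℝ => K * ENNReal.ofReal ((N / a) ^ 3 * a ^ m)) atTop (𝓝 0) := by
      have h1 : Tendsto (fun a : ℝ => a ^ (-(3 - m))) atTop (𝓝 0) := tendsto_rpow_neg_atTop (by linarith)
      have h2 : Tendsto (fun a : ℝ => N ^ 3 * a ^ (-(3 - m))) atTop (𝓝 (N ^ 3 * 0)) := h1.const_mul _
      rw [mul_zero] at h2
      have h3 : (fun a : ℝ => ENNReal.ofReal ((N / a) ^ 3 * a ^ m)) =ᶠ[atTop]
          fun a : ℝ => ENNReal.ofReal (N ^ 3 * a ^ (-(3 - m))) := by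
        filter_upwards [eventually_gt_atTop (0 : ℝ)] with a ha
        congr 1
        rw [div_pow, show -(3 - m) = m - ((3 : ℕ) : ℝ) by norm_num, Real.rpow_sub ha, Real.rpow_natCast]
        field_simp
      have h4 : Tendsto (fun a : ℝ => ENNReal.ofReal ((N / a) ^ 3 * a ^ m)) atTop (𝓝 0) := by
        rw [tendsto_congr' h3, ← ENNReal.ofReal_zero]
        exact ENNReal.tendsto_ofReal h2
      have h5 := ENNReal.Tendsto.const_mul h4 (Or.inr hK)
      rwa [mul_zero] at h5
    refine le_antisymm (ge_of_tendsto hlim ?_) bot_le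
    filter_upwards [eventually_ge_atTop a₀, eventually_ge_atTop N] with a ha hNa
    exact hbound N hN a ha hNa
  -- ## Step 3: `F = 0` a.e. on each `Q_N(S, 0)`, hence on the slab
  have hQN : ∀ N : ℝ, 0 < N → ∀ᵐ z ∂(volume.restrict (Ioo (S - N ^ 2) S ×ˢ ball (0 : EuclideanSpace ℝ (Fin 3)) N)),
      F z.1 z.2 = 0 := by
    intro N hN
    have h0 := hzero N hN
    rw [hQeq] at h0
    have hfm' : AEMeasurable f (volume.restrict (Ioo (S - N ^ 2) S ×ˢ ball (0 : EuclideanSpace ℝ (Fin 3)) N)) :=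
      hfm.mono_measure (Measure.restrict_mono (hQsub N) le_rfl)
    have h1 := (lintegral_eq_zero_iff' hfm').1 h0
    filter_upwards [h1] with z hz
    have hz' : ‖F z.1 z.2‖ₑ ^ r = 0 := hz
    rcases ENNReal.rpow_eq_zero_iff.1 hz' with h | h
    · exact enorm_eq_zero.1 h.1
    · exact absurd h.2 (not_lt.2 hr.le)
  have hcover : Iio S ×ˢ (univ : Set (EuclideanSpace ℝ (Fin 3))) ⊆
      ⋃ n : ℕ, Ioo (S - ((n : ℝ) + 1) ^ 2) S ×ˢ ball (0 : EuclideanSpace ℝ (Fin 3)) ((n : ℝ) + 1) := by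
    rintro ⟨t, x⟩ hz
    have ht : t < S := hz.1
    obtain ⟨n, hn⟩ := exists_nat_gt (max (S - t) ‖x‖)
    refine mem_iUnion.2 ⟨n, mem_prod.2 ⟨⟨?_, ht⟩, ?_⟩⟩
    · have h1 : S - t < (n : ℝ) + 1 := by linarith [le_max_left (S - t) ‖x‖]
      nlinarith [sub_pos.2 ht]
    · rw [mem_ball_zero_iff]
      linarith [le_max_right (S - t) ‖x‖]
  refine ae_restrict_of_ae_restrict_of_subset hcover ((ae_restrict_iUnion_iff _ _).2 fun n => ?_)
  exact hQN ((n : ℝ) + 1) (by positivity)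

end PressureSlaving

end Summit.NavierStokesRegularity.NavierStokesRegularity.Theorems.PowerGaugeEulerLiouville

end
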